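import Literature.MathematicalPhysics.QuantumFieldTheory.Balaban1983to89.B2Ineq329ZeroAveraging
import Literature.MathematicalPhysics.QuantumFieldTheory.Balaban1983to89.B2Restr216Lattice

/-!
# `Balaban1983to89.B2Ineq329PrismHolonomy` — [Balaban1982Higgs2] (3.29) p. 590 FOR A REGULAR NON-ZERO VECTOR FIELD `Ã`,
file 1/4: the torus geometry of the composite contours `Γ^{(k)}_{y,x}` of (I.2.2) under the straight translations
`x ↦ x + tεe_μ` (equivariance), the length `< d·Lᵏ` of `Γ^{(k)}_{y,x}` and the fact that its bonds start in `Bᵏ(y)`, and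
**the bound `|hol| ≤ 2d·L^{2k}·δ` on the abelian holonomy of the prism** `Γ^{(k)}_{y,x} ∪ [x, x + Lᵏεe_μ] ∪
(Γ^{(k)}_{y+e_μ,x+Lᵏεe_μ})⁻¹ ∪ ⟨y+e_μ, y⟩` for a vector field whose one-step differences are `≤ δ` on `Bᵏ(y) ∪ Bᵏ(y+e_μ)`
— the input «(1.21)» of [B4]'s proof of «Proposition 3.1′ of [2]» = (3.29), on the CONCRETE torus carrier
(`HiggsLattice` / `HiggsAveraging`)

statement-level skeleton of published theorems with citation tags; proofs where landed; nothing here is a claim about the Yang–Mills mass gap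

CITATION HEADER.  T. Bałaban, *(Higgs)₂,₃ quantum fields in a finite volume. II. An upper bound*, Commun. Math. Phys.
**86** (1982) 555–594 [Balaban1982Higgs2] (cell paper B2; PDF held `paper:balaban1982-cmp86-higgs23-ii`, journal page
= PDF page + 554; p. 589–590 [PDF 35–36] READ AS IMAGES on the ×2 renders
`run/shared/lean/pub/pub-balaban/b2b-balaban-ref1/pages/1982-cmp86-higgs23-II/1982-cmp86-higgs23-II-p035-x2.png`, `-p036-x2.png`);
T. Bałaban, *Regularity and decay of lattice Green's functions*, Commun. Math. Phys. **89** (1983) 571–597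
[Balaban1983RegularityDecay] (= [B4]; `paper:balaban1983-cmp89-regularity-decay`, journal page = PDF page + 570; p. 574
[PDF 4] and §4 pp. 589–591 [PDF 19–21] read on the ×2 renders `…/1983-cmp89-regularity-decay/…-p004/p019/p020-x2.png`);
part I [Balaban1982Higgs1], Commun. Math. Phys. **85** (1982) 603–626, (1.7) p. 605, (2.1)–(2.3) p. 608.
Cell `lit-balaban` (HOME `run/shared/lean/pub/lit-balaban/`), Phase-2 proof seat **p23** gen 9 (unit `lit-balaban-p23-g9`);
SKELETON rows **B2.Eq3.29** / **B2.Prop3.1** (owner r02, second reader r14, referee ref-4), their last residue = cell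
GAPS G-pv07-1: (3.29) for a RESTRICTED (regular, non-zero) `Ã` — the zero-field case is r14's
`B2Prop31ZeroField.formZ_ge` (ℤ^{d+1} carriers) and p15's `B2Prop31ZeroFieldConcrete.ineq329_zero_concrete` (this torus
carrier); [B4]'s regular-field theorem on the ℤ^{d+1} carriers is p35's `B4Prop31Regular.form122_lattice`, whose regions do
not transport to torus regions that wrap.  This file re-runs the geometric core of p35's recorded route (exact covariant
telescoping; holonomy through (1.21)) on the torus; files 2–4 (`B2Ineq329CovariantAveraging`, `B2Ineq329BlockPoincare`,
`B2Ineq329RegularField`) carry the covariant averaging inequality, the block Poincaré inequality and (3.29) itself.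
REUSED BY NAME, never restated: p15's torus block arithmetic `B2Ineq329ZeroAveraging.{val_blockIter,
blockIter_shiftN_apply_self/_ne, blockIter_shiftN_of_le, shiftN_*, sitesPerDir_zero_eq}`, p17's staircase corners
`B2Restr216Lattice.{cornerN, cornerN_zero, cornerN_d, toFinest_zero}`, the typer's `HiggsAveraging.{shiftN, segSum, corner,
contourSum, multiContourSum, toFinest, blockIter, blockK}`.

WHAT IS PRINTED.  [B2] p. 590 [PDF 36], verbatim: *"Now inequality (3.26) of the proposition follows from
⟨φ′_k, Δ⁽ᵏ⁾(Bᵏ(Λ_k), Ã^η)φ′_k⟩ ≥ γ₀(Σ_{⟨x,x′⟩⊂Λ_k} |U(Ã^η(⟨x,x′⟩))φ′_k(x′) − φ′_k(x)|² + Σ_{x∈Λ_k} m²(Lᵏε)²|φ′_k(x)|²)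
− O((Lᵏε)^{κ₀})|Λ_k|, (3.29) with a constant γ₀ independent of k, Λ_k and for φ′_k, Ã^η satisfying suitable restrictions.
This inequality will be proved together with the properties of the covariances (formulated in Propositions I.2.1 and
I.2.3)."*  [B4] p. 574 [PDF 4], verbatim: *"Proposition 3.1′ of [2]. Let Ω be a sum of unit blocks (i.e. Ω⁽ᵏ⁾ is an
arbitrary subset of Zᵈ) and let A satisfies the condition |(∂^η_μA)(x)| ≤ O(1)p(e) (p(e) = a₀(1 + log e⁻¹)ᵖ), (1.21) then
there exists a positive constant γ₀ depending on d only, such that for e sufficiently small ⟨φ, Δ⁽ᵏ⁾(Ω,A)φ⟩ ≥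
γ₀(Σ_{⟨x,x′⟩⊂Ω⁽ᵏ⁾}|U(A(⟨x,x′⟩))φ(x′) − φ(x)|² + m²Σ_{x∈Ω⁽ᵏ⁾}|φ(x)|²) − O(1)e^{2−α}Σ_{x∈Ω⁽ᵏ⁾}|φ(x)|² (1.22) … This
theorem implies (3.29) of [2]."*  [B4] p. 590 [PDF 20], verbatim: *"Using the regularity condition for A, we write A = A₀ + A′
on Δ(x,x′) with A₀ constant and A′ satisfying the bounds |A′|, |∂^η_μA′| ≤ O(1)p(e). We expand the expression on the left
hand side of (4.7) with respect to A′ …"*; [B1] p. 608: *"Γ^{(k)}_{y,x} = Γ_{y,x_{k−1}} ∪ Γ_{x_{k−1},x_{k−2}} ∪ … ∪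
Γ_{x₁,x}, y ∈ T⁽ᵏ⁾_{Lᵏε}, x ∈ Bᵏ(y). (2.2)"*.

DICTIONARY (print ↦ Lean; everything on the typer's concrete tori `Site P j`, level `k ≤ K`).  «A regular» (1.21) ↦ the
one-step differences of the bond variables are `≤ δ` in lattice units: `|Ã ⟨z + εe_ν, μ′⟩ − Ã ⟨z, μ′⟩| ≤ δ` for the
sites `z` of the relevant blocks (`δ` ↤ `ε·O(1)p(e)·(scale factors)`, the dictionary with `e = e(Lᵏε)` is written in file
4); the decomposition «A = A₀ + A′» and the first-order expansion of the print ↦ the EXACT identity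
`U(S)U(Γ′) = U(Γ)U(P)U(hol)` of the abelian transports (`U(a)U(b) = U(a+b)`, [B1] p. 605) with the circulation
`hol = S + Γ′ − Γ − P` around the prism, so that «terms of first order in A′» ↦ `|U(hol) − 1| ≤ ε|e||hol|` and the printed
smallness `O(1)p(e)·e` ↦ `ε|e|·2dL^{2k}δ` (file 2); the straight segment `[x, x + nεe_μ]` ↦ `segSum`/`shiftN`; the
staircase `Γ_{y,x}` ↦ `contourSum` with corners `cornerN`; `Γ^{(k)}_{y,x}` ↦ `multiContourSum`; translation by `tεe_μ` of
a vector field ↦ the lambda `fun b => Ã ⟨shiftN b.src μ t, b.dir⟩`.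

WHAT THIS MODULE PROVES (kernel-checked, 0 `sorry`, standard axioms; theorems only, no new definition, no `Prop` fact).
 §1 translations of `T_ε`: `shiftN_comm`, `shift_shiftN_comm`, equivariance `segSum_shiftN`, `corner_shiftN`, `sub_shiftN`,
    **`contourSum_shiftN`**, `val_toFinest`, **`toFinest_blockIter_shiftN`** (the block corners move with the site under
    `x ↦ x + Lⁱmεe_μ`), **`multiContourSum_shiftN`** (`Ã(Γ^{(k)}_{y+e_μ,x+Lᵏεe_μ}) = (τÃ)(Γ^{(k)}_{y,x})`), `multiContourSum_sub`.
 §2 the staircase as a bond family: `corner_eq_cornerN`, `shiftN_cornerN_succ`, **`abs_contourSum_le`** (bound by the number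
    of bonds), **`abs_sub_le_of_stair`** (telescoping a site function along the staircase).
 §3 geometry: `val_toFinest_blockIter`, `val_steps` (step counts = differences of corner labels), **`blockIter_stair_src`**
    (every bond of `Γ^{(k)}_{y,x}` starts in `Bᵏ(y)`), **`sum_steps_le`** (length `≤ d(Lᵏ − 1)`).
 §4 `abs_multiContourSum_le`, `abs_sub_le_of_multiStair` (the same along the composite contour).
 §5 **`abs_hol_le`**: `|Ã(⟨y,y+e_μ⟩) + Ã(Γ^{(k)}_{y+e_μ,x′}) − Ã(Γ^{(k)}_{y,x}) − Ã([x,x′])| ≤ 2d·L^{2k}·δ` for `x ∈ Bᵏ(y)`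
    under the `δ`-regularity on `Bᵏ(y) ∪ Bᵏ(y+e_μ)` (sweep through the `Lᵏ` unit translations; each thin loop = change of
    `Ã(Γ)` under one translation + telescoping of `Ã(⟨·,μ⟩)` along the translated contour, both `≤ (length)·δ`).
HONEST SCOPE.  (i) Nothing analytic: no statement of [B2]/[B4] is proved here; this is the lattice-geometric input of files
2–4.  (ii) The loop is swept in the single direction `μ`; the bound `2dL^{2k}δ` is the lineage's (the print works with
`O(1)p(e)e` after rescaling and never names this number).  (iii) Levels `k ≤ K` (the tori `Site P k` are meaningful there).
-/

open scoped BigOperators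

namespace Literature.MathematicalPhysics.QuantumFieldTheory.Balaban1983to89.B2Ineq329PrismHolonomy

open Finset
open Literature.MathematicalPhysics.QuantumFieldTheory.Balaban1983to89.HiggsLattice
open Literature.MathematicalPhysics.QuantumFieldTheory.Balaban1983to89.HiggsAveraging
open Literature.MathematicalPhysics.QuantumFieldTheory.Balaban1983to89.B2Ineq329ZeroAveraging
open Literature.MathematicalPhysics.QuantumFieldTheory.Balaban1983to89.B2Restr216Lattice (cornerN cornerN_zero cornerN_d
  toFinest_zero)

variable {P : Params} {N : ℕ}

/-! ## §1 Translations of `T_ε` by `tεe_μ`: commutation, translated vector fields, equivariance of the contours -/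

/-- Straight shifts in two directions commute. [cite: Balaban1982Higgs1, (2.1) p.608] -/
theorem shiftN_comm (u : Site P 0) (μ ν : Fin P.d) (s t : ℕ) :
    shiftN (shiftN u μ s) ν t = shiftN (shiftN u ν t) μ s := by
  by_cases h : ν = μ
  · subst h
    rw [shiftN_add, shiftN_add, Nat.add_comm]
  · unfold shiftN
    rw [Function.update_of_ne h, Function.update_of_ne (Ne.symm h), Function.update_comm h]

/-- One lattice step is the straight shift by one: `x + εe_ν = shiftN x ν 1`. [cite: Balaban1982Higgs1, (1.2) p.604] -/
theorem shift_eq_shiftN_one (x : Site P 0) (ν : Fin P.d) : x.shift ν = shiftN x ν 1 := by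
  unfold Site.shift shiftN
  rw [Nat.cast_one]

/-- `(x + tεe_μ) + εe_ν = (x + εe_ν) + tεe_μ`. [cite: Balaban1982Higgs1, (2.1) p.608] -/
theorem shift_shiftN_comm (x : Site P 0) (μ ν : Fin P.d) (t : ℕ) :
    (shiftN x μ t).shift ν = shiftN (x.shift ν) μ t := by
  rw [shift_eq_shiftN_one, shift_eq_shiftN_one, shiftN_comm]

/-- The vector field translated by `tεe_μ`, `(τ_tA)(b) = A(b + tεe_μ)`, is written below as the lambda
`fun b => A ⟨shiftN b.src μ t, b.dir⟩`; at `t = 0` it is `A`. [cite: Balaban1982Higgs1, (2.3) p.608] -/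
theorem shiftField_zero (A : VecField P 0) (μ : Fin P.d) :
    (fun b : PBond P 0 => A ⟨shiftN b.src μ 0, b.dir⟩) = A := by
  funext b
  rw [shiftN_zero']

/-- `A(⟨u + Tεe_μ, u + Tεe_μ + mεe_ν⟩) = (τ_T A)(⟨u, u + mεe_ν⟩)`. [cite: Balaban1982Higgs1, (2.3) p.608] -/
theorem segSum_shiftN (A : VecField P 0) (u : Site P 0) (μ ν : Fin P.d) (T m : ℕ) :
    segSum A (shiftN u μ T) ν m = segSum (fun b : PBond P 0 => A ⟨shiftN b.src μ T, b.dir⟩) u ν m := by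
  unfold segSum
  refine Finset.sum_congr rfl fun i _ => ?_
  rw [shiftN_comm]

/-- The corners of the staircase are translated with its endpoints. [cite: Balaban1982Higgs1, (2.1) p.608] -/
theorem corner_shiftN (Y X : Site P 0) (μ : Fin P.d) (T : ℕ) (i : Fin P.d) :
    corner (shiftN Y μ T) (shiftN X μ T) i = shiftN (corner Y X i) μ T := by
  funext j
  by_cases hj : j = μ
  · subst hj
    by_cases hji : j ≤ i
    · simp [corner, hji, shiftN_apply_self]
    · simp [corner, hji, shiftN_apply_self]
  · by_cases hji : j ≤ i
    · simp [corner, hji, shiftN_apply_ne _ hj]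
    · simp [corner, hji, shiftN_apply_ne _ hj]

/-- The numbers of steps of the staircase are translation invariant. [cite: Balaban1982Higgs1, (2.1) p.608] -/
theorem sub_shiftN (Y X : Site P 0) (μ : Fin P.d) (T : ℕ) (i : Fin P.d) :
    (shiftN X μ T) i - (shiftN Y μ T) i = X i - Y i := by
  by_cases hi : i = μ
  · subst hi
    rw [shiftN_apply_self, shiftN_apply_self, add_sub_add_right_eq_sub]
  · rw [shiftN_apply_ne _ hi, shiftN_apply_ne _ hi]

/-- **Translation equivariance of the staircase sums**: `A(Γ_{y+Tεe_μ, x+Tεe_μ}) = (τ_T A)(Γ_{y,x})`.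
[cite: Balaban1982Higgs1, (2.1) p.608] -/
theorem contourSum_shiftN (A : VecField P 0) (Y X : Site P 0) (μ : Fin P.d) (T : ℕ) :
    contourSum A (shiftN Y μ T) (shiftN X μ T) = contourSum (fun b : PBond P 0 => A ⟨shiftN b.src μ T, b.dir⟩) Y X := by
  unfold contourSum
  refine Finset.sum_congr rfl fun i _ => ?_
  rw [corner_shiftN, sub_shiftN, segSum_shiftN]

/-- The label of `T⁽ⁱ⁾ ⊂ T_ε`: `(toFinest z)_ν = Lⁱ·z_ν` (`i ≤ K`, no reduction). [cite: Balaban1982Higgs1, (1.20) p.607] -/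
theorem val_toFinest {i : ℕ} (hi : i ≤ P.K) (z : Site P i) (ν : Fin P.d) :
    ((toFinest z) ν).val = (z ν).val * P.L ^ i := by
  simp only [toFinest]
  rw [ZMod.val_natCast, Nat.mod_eq_of_lt]
  rw [sitesPerDir_zero_eq hi ν, mul_comm (P.L ^ i)]
  exact Nat.mul_lt_mul_of_pos_right (ZMod.val_lt _) (pow_pos P.hL i)

/-- **The block corners are translated with the site**: `x ↦ x + Lⁱm·εe_μ` moves the corner of its `i`-block by the same
vector. [cite: Balaban1982Higgs1, (1.20) p.607] -/
theorem toFinest_blockIter_shiftN {i : ℕ} (hi : i ≤ P.K) (x : Site P 0) (μ : Fin P.d) (m : ℕ) :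
    toFinest (blockIter i (shiftN x μ (P.L ^ i * m))) = shiftN (toFinest (blockIter i x)) μ (P.L ^ i * m) := by
  funext ν
  by_cases hν : ν = μ
  · subst hν
    rw [shiftN_apply_self]
    simp only [toFinest]
    rw [blockIter_shiftN_apply_self hi, ZMod.val_natCast, blockIter_apply_eq_cast hi, ZMod.val_natCast,
      Nat.mod_eq_of_lt (a := (x ν).val / P.L ^ i), ← Nat.cast_add]
    · have hN : P.sitesPerDir 0 ν = P.L ^ i * P.sitesPerDir i ν := sitesPerDir_zero_eq hi ν
      rw [Nat.mul_comm (P.L ^ i) m, Nat.add_mul_div_right _ _ (pow_pos P.hL i)]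
      rw [ZMod.natCast_eq_natCast_iff']
      generalize (x ν).val / P.L ^ i = q
      rw [hN, Nat.mul_comm (P.L ^ i) (P.sitesPerDir i ν), ← Nat.mul_mod_mul_right, Nat.mod_mod]
      congr 1
      ring
    · rw [← val_blockIter hi]
      exact ZMod.val_lt _
  · rw [shiftN_apply_ne _ hν]
    simp only [toFinest]
    rw [blockIter_shiftN_apply_ne hi x hν]


/-- **Translation equivariance of the composite contours (I.2.2)** by one coarse spacing at level `k ≤ K`:
`A(Γ^{(k)}_{y + e_μ, x + Lᵏεe_μ}) = (τ_{Lᵏ} A)(Γ^{(k)}_{y,x})` — every block corner of `x + Lᵏεe_μ` is the corresponding corner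
of `x` moved by `Lᵏεe_μ`. [cite: Balaban1982Higgs1, (2.2) p.608] -/
theorem multiContourSum_shiftN {k : ℕ} (hk : k ≤ P.K) (A : VecField P 0) (x : Site P 0) (μ : Fin P.d) :
    multiContourSum A k (shiftN x μ (P.L ^ k)) = multiContourSum (fun b : PBond P 0 => A ⟨shiftN b.src μ (P.L ^ k), b.dir⟩) k x := by
  unfold multiContourSum
  refine Finset.sum_congr rfl fun i hi => ?_
  have hik : i < k := Finset.mem_range.1 hi
  have e1 : P.L ^ k = P.L ^ (i + 1) * P.L ^ (k - (i + 1)) := by rw [← pow_add]; congr 1; omega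
  have e2 : P.L ^ k = P.L ^ i * P.L ^ (k - i) := by rw [← pow_add]; congr 1; omega
  have h1 : toFinest (blockIter (i + 1) (shiftN x μ (P.L ^ k))) = shiftN (toFinest (blockIter (i + 1) x)) μ (P.L ^ k) := by
    rw [e1]; exact toFinest_blockIter_shiftN (by omega) x μ _
  have h2 : toFinest (blockIter i (shiftN x μ (P.L ^ k))) = shiftN (toFinest (blockIter i x)) μ (P.L ^ k) := by
    rw [e2]; exact toFinest_blockIter_shiftN (by omega) x μ _
  rw [h1, h2, contourSum_shiftN]

/-- (I.2.3) for the composite contour is additive under subtraction of fields. [cite: Balaban1982Higgs1, (2.2) p.608] -/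
theorem multiContourSum_sub (A B : VecField P 0) (k : ℕ) (x : Site P 0) :
    multiContourSum (A - B) k x = multiContourSum A k x - multiContourSum B k x := by
  simp [multiContourSum, contourSum, segSum, Finset.sum_sub_distrib]

/-! ## §2 The bonds of a staircase: corners, step counts, and the two telescoping bounds -/

/-- `HiggsAveraging.corner y x i = cornerN y x (i+1)` (p17's integer-threshold corners). [cite: Balaban1982Higgs1, (2.1) p.608] -/
theorem corner_eq_cornerN (Y X : Site P 0) (i : Fin P.d) : corner Y X i = cornerN Y X (i + 1) := by
  funext j
  simp only [corner, cornerN]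
  by_cases h : j ≤ i
  · rw [if_pos h, if_pos (Nat.lt_succ_of_le h)]
  · rw [if_neg h, if_neg (fun h' => h (Nat.le_of_lt_succ h'))]

/-- The segment of the staircase in direction `ν` ends at the next corner: `cornerN (ν+1) + m_ν εe_ν = cornerN ν`,
`m_ν = (x_ν − y_ν)`. [cite: Balaban1982Higgs1, (2.1) p.608] -/
theorem shiftN_cornerN_succ (Y X : Site P 0) (ν : Fin P.d) :
    shiftN (cornerN Y X (ν + 1)) ν (X ν - Y ν).val = cornerN Y X ν := by
  funext j
  by_cases hj : j = ν
  · subst hj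
    rw [shiftN_apply_self, ZMod.natCast_zmod_val]
    simp [cornerN]
  · rw [shiftN_apply_ne _ hj]
    have : (j : ℕ) ≠ ν := fun h => hj (Fin.ext h)
    simp only [cornerN]
    split_ifs <;> first | rfl | omega

/-- **Bound of a staircase sum by the number of its bonds**: if `|B(b)| ≤ β` on every bond `b = ⟨cornerN(ν+1) + sεe_ν, ν⟩`,
`s < m_ν`, of `Γ_{y,x}`, then `|B(Γ_{y,x})| ≤ (Σ_ν m_ν)·β`. [cite: Balaban1982Higgs1, (2.3) p.608] -/
theorem abs_contourSum_le (B : VecField P 0) (Y X : Site P 0) {β : ℝ}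
    (hB : ∀ (ν : Fin P.d) (s : ℕ), s < (X ν - Y ν).val → |B ⟨shiftN (cornerN Y X (ν + 1)) ν s, ν⟩| ≤ β) :
    |contourSum B Y X| ≤ (∑ ν : Fin P.d, ((X ν - Y ν).val : ℝ)) * β := by
  unfold contourSum
  rw [Finset.sum_mul]
  refine (Finset.abs_sum_le_sum_abs _ _).trans (Finset.sum_le_sum fun ν _ => ?_)
  unfold segSum
  rw [corner_eq_cornerN]
  refine (Finset.abs_sum_le_sum_abs _ _).trans ?_
  calc ∑ i ∈ Finset.range (X ν - Y ν).val, |B ⟨shiftN (cornerN Y X (ν + 1)) ν i, ν⟩|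
      ≤ ∑ _i ∈ Finset.range (X ν - Y ν).val, β := Finset.sum_le_sum fun i hi => hB ν i (Finset.mem_range.1 hi)
    _ = ((X ν - Y ν).val : ℝ) * β := by rw [Finset.sum_const, Finset.card_range, nsmul_eq_mul]

/-- **Telescoping a site function along the staircase**: if `|g(p + εe_ν) − g(p)| ≤ δ` at every bond `⟨p, ν⟩` of `Γ_{y,x}`,
then `|g(x) − g(y)| ≤ (Σ_ν m_ν)·δ`. [cite: Balaban1982Higgs1, (2.1) p.608] -/
theorem abs_sub_le_of_stair (g : Site P 0 → ℝ) (Y X : Site P 0) {δ : ℝ}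
    (hg : ∀ (ν : Fin P.d) (s : ℕ), s < (X ν - Y ν).val →
      |g ((shiftN (cornerN Y X (ν + 1)) ν s).shift ν) - g (shiftN (cornerN Y X (ν + 1)) ν s)| ≤ δ) :
    |g X - g Y| ≤ (∑ ν : Fin P.d, ((X ν - Y ν).val : ℝ)) * δ := by
  -- telescoping over the corners `cornerN 0 = X, …, cornerN d = Y`
  have htel : g X - g Y = ∑ t ∈ Finset.range P.d, (g (cornerN Y X t) - g (cornerN Y X (t + 1))) := by
    rw [Finset.sum_range_sub' (fun t => g (cornerN Y X t)), cornerN_zero, cornerN_d]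
  -- each corner-to-corner difference telescopes along its segment
  have hseg : ∀ ν : Fin P.d, |g (cornerN Y X ν) - g (cornerN Y X (ν + 1))| ≤ ((X ν - Y ν).val : ℝ) * δ := by
    intro ν
    set u := cornerN Y X (ν + 1) with hu
    have e : g (cornerN Y X ν) - g u
        = ∑ s ∈ Finset.range (X ν - Y ν).val, (g (shiftN u ν (s + 1)) - g (shiftN u ν s)) := by
      rw [Finset.sum_range_sub (fun s => g (shiftN u ν s)), shiftN_zero', hu, shiftN_cornerN_succ]
    rw [e]
    refine (Finset.abs_sum_le_sum_abs _ _).trans ?_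
    calc ∑ s ∈ Finset.range (X ν - Y ν).val, |g (shiftN u ν (s + 1)) - g (shiftN u ν s)|
        ≤ ∑ _s ∈ Finset.range (X ν - Y ν).val, δ := Finset.sum_le_sum fun s hs => by
          rw [← shift_shiftN]; exact hg ν s (Finset.mem_range.1 hs)
      _ = ((X ν - Y ν).val : ℝ) * δ := by rw [Finset.sum_const, Finset.card_range, nsmul_eq_mul]
  rw [htel, Finset.sum_mul, Finset.sum_range]
  exact (Finset.abs_sum_le_sum_abs _ _).trans (Finset.sum_le_sum fun ν _ => hseg ν)


/-! ## §3 Geometry of the composite contour `Γ^{(k)}_{y,x}`: its bonds start in `Bᵏ(y)`; its length is `< d·Lᵏ` -/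

section Geometry

variable {k : ℕ}

/-- The label of the corner of the `i`-block of `x`: `Lⁱ⌊x_ν/Lⁱ⌋`. [cite: Balaban1982Higgs1, (1.20) p.607] -/
theorem val_toFinest_blockIter {i : ℕ} (hi : i ≤ P.K) (x : Site P 0) (ν : Fin P.d) :
    ((toFinest (blockIter i x)) ν).val = (x ν).val / P.L ^ i * P.L ^ i := by
  rw [val_toFinest hi, val_blockIter hi]

/-- `Lⁱ⌊v/Lⁱ⌋ ≤ v`. [folklore] -/
private theorem cl_le (v n : ℕ) : v / n * n ≤ v := Nat.div_mul_le_self v n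

/-- The corner labels decrease with the level: `Lᵏ⌊v/Lᵏ⌋ ≤ Lⁱ⌊v/Lⁱ⌋` for `i ≤ k`. [folklore] -/
private theorem cl_mono {i k : ℕ} (hik : i ≤ k) (v : ℕ) : v / P.L ^ k * P.L ^ k ≤ v / P.L ^ i * P.L ^ i := by
  have hLi : 0 < P.L ^ i := pow_pos P.hL i
  have hdvd : P.L ^ i ∣ v / P.L ^ k * P.L ^ k := Dvd.dvd.mul_left (pow_dvd_pow P.L hik) _
  calc v / P.L ^ k * P.L ^ k = (v / P.L ^ k * P.L ^ k) / P.L ^ i * P.L ^ i := (Nat.div_mul_cancel hdvd).symm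
    _ ≤ v / P.L ^ i * P.L ^ i := Nat.mul_le_mul_right _ (Nat.div_le_div_right (cl_le v _))

/-- A label between the `k`-corner label of `v` and `v` has the same `k`-block label. [folklore] -/
private theorem div_eq_of_window {k v c : ℕ} (h1 : v / P.L ^ k * P.L ^ k ≤ c) (h2 : c ≤ v) : c / P.L ^ k = v / P.L ^ k := by
  have hLk : 0 < P.L ^ k := pow_pos P.hL k
  refine le_antisymm (Nat.div_le_div_right h2) ?_
  calc v / P.L ^ k = v / P.L ^ k * P.L ^ k / P.L ^ k := (Nat.mul_div_cancel _ hLk).symm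
    _ ≤ c / P.L ^ k := Nat.div_le_div_right h1

/-- **The number of steps of the level-`i` piece of `Γ^{(k)}_{y,x}` in direction `ν`** is the difference of corner labels
`Lⁱ⌊x_ν/Lⁱ⌋ − Lⁱ⁺¹⌊x_ν/Lⁱ⁺¹⌋` (`i + 1 ≤ K`). [cite: Balaban1982Higgs1, (2.2) p.608] -/
theorem val_steps {i : ℕ} (hi : i + 1 ≤ P.K) (x : Site P 0) (ν : Fin P.d) :
    ((toFinest (blockIter i x)) ν - (toFinest (blockIter (i + 1) x)) ν).val
      = (x ν).val / P.L ^ i * P.L ^ i - (x ν).val / P.L ^ (i + 1) * P.L ^ (i + 1) := by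
  have h : ((toFinest (blockIter (i + 1) x)) ν).val ≤ ((toFinest (blockIter i x)) ν).val := by
    rw [val_toFinest_blockIter (i := i + 1) hi, val_toFinest_blockIter (i := i) (by omega)]
    exact cl_mono (Nat.le_succ i) _
  rw [ZMod.val_sub h, val_toFinest_blockIter (i := i + 1) hi, val_toFinest_blockIter (i := i) (by omega)]

/-- **The bonds of `Γ^{(k)}_{y,x}` start in `Bᵏ(y)`**: every bond `⟨cornerN(ν+1) + sεe_ν, ν⟩`, `s < m_{i,ν}`, of the level-`i`
staircase (`i < k ≤ K`) has its initial point in the `k`-block of `x`. [cite: Balaban1982Higgs1, (2.2) p.608] -/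
theorem blockIter_stair_src {i : ℕ} (hik : i < k) (hk : k ≤ P.K) (x : Site P 0) (ν : Fin P.d) {s : ℕ}
    (hs : s < ((toFinest (blockIter i x)) ν - (toFinest (blockIter (i + 1) x)) ν).val) :
    blockIter k (shiftN (cornerN (toFinest (blockIter (i + 1) x)) (toFinest (blockIter i x)) (ν + 1)) ν s)
      = blockIter k x := by
  have hi1 : i + 1 ≤ P.K := by omega
  rw [val_steps hi1] at hs
  funext j
  apply ZMod.val_injective
  rw [val_blockIter hk, val_blockIter hk]
  by_cases hj : j = ν
  · subst hj
    rw [val_shiftN]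
    have hc : ((cornerN (toFinest (blockIter (i + 1) x)) (toFinest (blockIter i x)) (j + 1)) j).val
        = (x j).val / P.L ^ (i + 1) * P.L ^ (i + 1) := by
      simp only [cornerN, Nat.lt_succ_self, if_true]
      exact val_toFinest_blockIter hi1 x j
    rw [hc]
    have hlt : (x j).val / P.L ^ (i + 1) * P.L ^ (i + 1) + s < P.sitesPerDir 0 j := by
      have := cl_le (x j).val (P.L ^ i)
      have := ZMod.val_lt (x j)
      omega
    rw [Nat.mod_eq_of_lt hlt]
    refine div_eq_of_window ((cl_mono (Nat.succ_le_of_lt hik) _).trans (Nat.le_add_right _ _)) ?_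
    have := cl_le (x j).val (P.L ^ i)
    omega
  · rw [shiftN_apply_ne _ hj]
    have hjν : (j : ℕ) ≠ ν := fun h => hj (Fin.ext h)
    simp only [cornerN]
    split_ifs
    · rw [val_toFinest_blockIter hi1]
      exact div_eq_of_window (cl_mono (by omega) _) (cl_le _ _)
    · rw [val_toFinest_blockIter (by omega)]
      exact div_eq_of_window (cl_mono hik.le _) (cl_le _ _)

/-- **The length of `Γ^{(k)}_{y,x}` is less than `d·Lᵏ`**: `Σ_{i<k} Σ_ν m_{i,ν} = Σ_ν (x_ν − Lᵏ⌊x_ν/Lᵏ⌋) ≤ d·(Lᵏ − 1)` (`k ≤ K`).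
[cite: Balaban1982Higgs1, (2.2) p.608] -/
theorem sum_steps_le (hk : k ≤ P.K) (x : Site P 0) :
    ∑ i ∈ Finset.range k, ∑ ν : Fin P.d,
        (((toFinest (blockIter i x)) ν - (toFinest (blockIter (i + 1) x)) ν).val : ℝ)
      ≤ P.d * ((P.L : ℝ) ^ k - 1) := by
  rw [Finset.sum_comm]
  have hν : ∀ ν : Fin P.d, ∑ i ∈ Finset.range k,
      (((toFinest (blockIter i x)) ν - (toFinest (blockIter (i + 1) x)) ν).val : ℝ) ≤ (P.L : ℝ) ^ k - 1 := by
    intro ν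
    have e : ∀ i ∈ Finset.range k, (((toFinest (blockIter i x)) ν - (toFinest (blockIter (i + 1) x)) ν).val : ℝ)
        = ((x ν).val / P.L ^ i * P.L ^ i : ℕ) - ((x ν).val / P.L ^ (i + 1) * P.L ^ (i + 1) : ℕ) := by
      intro i hi
      have hi1 : i + 1 ≤ P.K := by have := Finset.mem_range.1 hi; omega
      rw [val_steps hi1, Nat.cast_sub (cl_mono (Nat.le_succ i) _)]
    rw [Finset.sum_congr rfl e, Finset.sum_range_sub' (fun i => (((x ν).val / P.L ^ i * P.L ^ i : ℕ) : ℝ))]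
    simp only [pow_zero, Nat.div_one, mul_one]
    have hmod : ((x ν).val : ℝ) - (((x ν).val / P.L ^ k * P.L ^ k : ℕ) : ℝ) = (((x ν).val % P.L ^ k : ℕ) : ℝ) := by
      rw [sub_eq_iff_eq_add, ← Nat.cast_add, Nat.mod_add_div' (x ν).val (P.L ^ k)]
    have hlt : (x ν).val % P.L ^ k + 1 ≤ P.L ^ k := Nat.mod_lt _ (pow_pos P.hL k)
    have hcast : (((x ν).val % P.L ^ k : ℕ) : ℝ) + 1 ≤ (P.L : ℝ) ^ k := by exact_mod_cast hlt
    rw [hmod]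
    linarith
  calc ∑ ν : Fin P.d, ∑ i ∈ Finset.range k,
        (((toFinest (blockIter i x)) ν - (toFinest (blockIter (i + 1) x)) ν).val : ℝ)
      ≤ ∑ _ν : Fin P.d, ((P.L : ℝ) ^ k - 1) := Finset.sum_le_sum fun ν _ => hν ν
    _ = P.d * ((P.L : ℝ) ^ k - 1) := by rw [Finset.sum_const, Finset.card_univ, Fintype.card_fin, nsmul_eq_mul]

end Geometry


/-! ## §4 The composite contour: bound by its length, telescoping of a site function along it -/

section Composite

variable {k : ℕ}

/-- **Bound of `B(Γ^{(k)}_{y,x})` by the length of the contour**: if `|B(b)| ≤ β` on every bond of every level-`i` staircase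
of `Γ^{(k)}_{y,x}`, then `|B(Γ^{(k)}_{y,x})| ≤ (Σ_{i<k} Σ_ν m_{i,ν})·β`. [cite: Balaban1982Higgs1, (2.2) p.608] -/
theorem abs_multiContourSum_le (B : VecField P 0) (k : ℕ) (x : Site P 0) {β : ℝ}
    (hB : ∀ i, i < k → ∀ (ν : Fin P.d) (s : ℕ),
      s < ((toFinest (blockIter i x)) ν - (toFinest (blockIter (i + 1) x)) ν).val →
      |B ⟨shiftN (cornerN (toFinest (blockIter (i + 1) x)) (toFinest (blockIter i x)) (ν + 1)) ν s, ν⟩| ≤ β) :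
    |multiContourSum B k x|
      ≤ (∑ i ∈ Finset.range k, ∑ ν : Fin P.d,
          (((toFinest (blockIter i x)) ν - (toFinest (blockIter (i + 1) x)) ν).val : ℝ)) * β := by
  unfold multiContourSum
  rw [Finset.sum_mul]
  refine (Finset.abs_sum_le_sum_abs _ _).trans (Finset.sum_le_sum fun i hi => ?_)
  exact abs_contourSum_le B _ _ (hB i (Finset.mem_range.1 hi))

/-- **Telescoping a site function along `Γ^{(k)}_{y,x}`** from the block corner `toFinest y` (`y = x_k`) to `x`: if
`|g(p + εe_ν) − g(p)| ≤ δ` at every bond `⟨p, ν⟩` of the contour, then `|g(x) − g(corner)| ≤ (length)·δ`.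
[cite: Balaban1982Higgs1, (2.2) p.608] -/
theorem abs_sub_le_of_multiStair (g : Site P 0 → ℝ) (k : ℕ) (x : Site P 0) {δ : ℝ}
    (hg : ∀ i, i < k → ∀ (ν : Fin P.d) (s : ℕ),
      s < ((toFinest (blockIter i x)) ν - (toFinest (blockIter (i + 1) x)) ν).val →
      |g ((shiftN (cornerN (toFinest (blockIter (i + 1) x)) (toFinest (blockIter i x)) (ν + 1)) ν s).shift ν)
        - g (shiftN (cornerN (toFinest (blockIter (i + 1) x)) (toFinest (blockIter i x)) (ν + 1)) ν s)| ≤ δ) :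
    |g x - g (toFinest (blockIter k x))|
      ≤ (∑ i ∈ Finset.range k, ∑ ν : Fin P.d,
          (((toFinest (blockIter i x)) ν - (toFinest (blockIter (i + 1) x)) ν).val : ℝ)) * δ := by
  have htel : g x - g (toFinest (blockIter k x))
      = ∑ i ∈ Finset.range k, (g (toFinest (blockIter i x)) - g (toFinest (blockIter (i + 1) x))) := by
    rw [Finset.sum_range_sub' (fun i => g (toFinest (blockIter i x)))]
    simp [blockIter, toFinest_zero]
  rw [htel, Finset.sum_mul]
  refine (Finset.abs_sum_le_sum_abs _ _).trans (Finset.sum_le_sum fun i hi => ?_)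
  exact abs_sub_le_of_stair g _ _ (hg i (Finset.mem_range.1 hi))

end Composite

/-! ## §5 The abelian holonomy of the prism `Γ^{(k)}_{y,x} ∪ [x, x + Lᵏεe_μ] ∪ (Γ^{(k)}_{y′,x′})⁻¹ ∪ ⟨y′, y⟩` -/

section Holonomy

variable {k : ℕ}

/-- **THE HOLONOMY BOUND**.  For `x ∈ Bᵏ(y)`, `x′ = x + Lᵏεe_μ`, `y′ = y + e_μ` and a vector field `Ã` whose one-step
differences are `≤ δ` at every point of `Bᵏ(y) ∪ Bᵏ(y′)` ((1.21) of [B4] in lattice units), the circulation of `Ã` around the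
closed path `y →(straight) y′ →(Γ^{(k)}) x′ ←([x,x′]) x ←(Γ^{(k)}) y`,
`hol = Ã(⟨y,y′⟩) + Ã(Γ^{(k)}_{y′,x′}) − Ã(Γ^{(k)}_{y,x}) − Ã([x,x′])`, satisfies `|hol| ≤ 2d·L^{2k}·δ`
(sweep the contour through the `Lᵏ` unit translations in direction `μ`; each thin loop costs twice the length `< dLᵏ` of
the contour times `δ`).  The transports being `U(a)U(b) = U(a+b)` (p. 605), this number IS the holonomy of the loop.
[cite: Balaban1983RegularityDecay, (1.21)–(1.22) p.574; §4 pp.589–591] [cite: Balaban1982Higgs1, (2.2) p.608] -/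
theorem abs_hol_le (hk : k ≤ P.K) (A : VecField P 0) (y : Site P k) (μ : Fin P.d) {x : Site P 0}
    (hx : x ∈ blockK k y) {δ : ℝ} (hδ : 0 ≤ δ)
    (hreg : ∀ z : Site P 0, (blockIter k z = y ∨ blockIter k z = y.shift μ) →
      ∀ μ' ν : Fin P.d, |A ⟨z.shift ν, μ'⟩ - A ⟨z, μ'⟩| ≤ δ) :
    |segSum A (toFinest y) μ (P.L ^ k) + multiContourSum A k (shiftN x μ (P.L ^ k))
        - multiContourSum A k x - segSum A x μ (P.L ^ k)| ≤ 2 * P.d * ((P.L : ℝ) ^ k) ^ 2 * δ := by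
  rw [mem_blockK] at hx
  set n : ℕ := P.L ^ k with hn
  set M : ℝ := ∑ i ∈ Finset.range k, ∑ ν : Fin P.d,
    (((toFinest (blockIter i x)) ν - (toFinest (blockIter (i + 1) x)) ν).val : ℝ) with hM
  have hMle : M ≤ P.d * (n : ℝ) := by
    have h := sum_steps_le hk x
    have hd : (0 : ℝ) ≤ P.d := Nat.cast_nonneg _
    have : (P.d : ℝ) * ((P.L : ℝ) ^ k - 1) ≤ P.d * (n : ℝ) := by
      rw [hn]; push_cast; nlinarith
    exact h.trans this
  -- membership of the swept contour points in `Bᵏ(y) ∪ Bᵏ(y′)`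
  have hmem : ∀ i, i < k → ∀ (ν : Fin P.d) (s : ℕ),
      s < ((toFinest (blockIter i x)) ν - (toFinest (blockIter (i + 1) x)) ν).val → ∀ t, t ≤ n →
      blockIter k (shiftN (shiftN (cornerN (toFinest (blockIter (i + 1) x)) (toFinest (blockIter i x)) (ν + 1)) ν s) μ t) = y
        ∨ blockIter k (shiftN (shiftN (cornerN (toFinest (blockIter (i + 1) x)) (toFinest (blockIter i x)) (ν + 1)) ν s) μ t)
          = y.shift μ := by
    intro i hi ν s hs t ht
    have h := blockIter_shiftN_of_le hk
      (shiftN (cornerN (toFinest (blockIter (i + 1) x)) (toFinest (blockIter i x)) (ν + 1)) ν s) μ ht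
    rwa [blockIter_stair_src hi hk x ν hs, hx] at h
  -- the swept family `F t = (τ_t Ã)(Γ^{(k)}_{y,x})`
  set F : ℕ → ℝ := fun t => multiContourSum (fun b : PBond P 0 => A ⟨shiftN b.src μ t, b.dir⟩) k x with hF
  have hFn : multiContourSum A k (shiftN x μ n) = F n := by rw [hF, hn]; exact multiContourSum_shiftN hk A x μ
  have hF0 : multiContourSum A k x = F 0 := by simp only [hF, shiftField_zero]
  have hstep : ∀ t, t < n → |F (t + 1) - F t| ≤ M * δ := by
    intro t ht
    have e : F (t + 1) - F t = multiContourSum ((fun b : PBond P 0 => A ⟨shiftN b.src μ (t + 1), b.dir⟩)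
        - (fun b : PBond P 0 => A ⟨shiftN b.src μ t, b.dir⟩)) k x := by
      rw [hF]; exact (multiContourSum_sub _ _ k x).symm
    rw [e]
    refine abs_multiContourSum_le _ k x fun i hi ν s hs => ?_
    rw [Pi.sub_apply, ← shift_shiftN]
    exact hreg _ (hmem i hi ν s hs t ht.le) ν μ
  have hside : ∀ t, t < n → |A ⟨shiftN x μ t, μ⟩ - A ⟨shiftN (toFinest y) μ t, μ⟩| ≤ M * δ := by
    intro t ht
    rw [← hx]
    refine abs_sub_le_of_multiStair (fun p => A ⟨shiftN p μ t, μ⟩) k x fun i hi ν s hs => ?_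
    show |A ⟨shiftN _ μ t, μ⟩ - A ⟨shiftN _ μ t, μ⟩| ≤ δ
    rw [← shift_shiftN_comm]
    exact hreg _ (hmem i hi ν s hs t ht.le) μ ν
  -- the circulation as the sum of the thin loops
  have hsum : segSum A (toFinest y) μ n + multiContourSum A k (shiftN x μ n) - multiContourSum A k x - segSum A x μ n
      = ∑ t ∈ Finset.range n, ((F (t + 1) - F t) - (A ⟨shiftN x μ t, μ⟩ - A ⟨shiftN (toFinest y) μ t, μ⟩)) := by
    rw [Finset.sum_sub_distrib, Finset.sum_range_sub, Finset.sum_sub_distrib, hFn, hF0]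
    unfold segSum
    ring
  rw [hsum]
  calc |∑ t ∈ Finset.range n, ((F (t + 1) - F t) - (A ⟨shiftN x μ t, μ⟩ - A ⟨shiftN (toFinest y) μ t, μ⟩))|
      ≤ ∑ t ∈ Finset.range n, |(F (t + 1) - F t) - (A ⟨shiftN x μ t, μ⟩ - A ⟨shiftN (toFinest y) μ t, μ⟩)| :=
        Finset.abs_sum_le_sum_abs _ _
    _ ≤ ∑ _t ∈ Finset.range n, 2 * (M * δ) := Finset.sum_le_sum fun t ht => by
        have h1 := hstep t (Finset.mem_range.1 ht)
        have h2 := hside t (Finset.mem_range.1 ht)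
        have h3 := abs_sub _ _ |>.trans (add_le_add h1 h2)
        linarith
    _ = n * (2 * (M * δ)) := by rw [Finset.sum_const, Finset.card_range, nsmul_eq_mul]
    _ ≤ n * (2 * (P.d * n * δ)) := by
        have hn0 : (0 : ℝ) ≤ n := Nat.cast_nonneg _
        have : M * δ ≤ P.d * n * δ := mul_le_mul_of_nonneg_right hMle hδ
        nlinarith
    _ = 2 * P.d * ((P.L : ℝ) ^ k) ^ 2 * δ := by rw [hn]; push_cast; ring

end Holonomy

end Literature.MathematicalPhysics.QuantumFieldTheory.Balaban1983to89.B2Ineq329PrismHolonomy
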